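import Literature.NumberTheory.DiophantineGeometry.AbelianSchemeModelReduction
import Literature.AlgebraicGeometry.Motives.AbelianVarietyGoodReductionCofinite
import Literature.AlgebraicGeometry.Motives.AbelianVarietyTorsionPointsCountProofs
import HarnessLib

/-!
# The reduction map of an abelian-scheme model on prime-to-`v` torsion: injectivity from unramified `[N]`, and
# bijectivity from injectivity (Serre–Tate 1968, §1 Lemma 2)

Topic `Literature/NumberTheory/DiophantineGeometry`; namespace `Literature.NumberTheory.DiophantineGeometry`.  THEOREMS
ONLY (no definition, no named fact, no instance; debt 0).  Cell `hodgecm-mathlib`, background programme «R-pkg» (the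
`ℓ`-adic specialisation datum `TateSpecialisation` for PRODUCED good-reduction data, row VI-NOS-2 `nonempty_tateSpecialisation`
in the abelian-scheme currency; lead B-p20, piece T1).

Let `A` be an abelian variety over a number field `K`, `v` a finite place, `𝒜 → Spec 𝓞_{K,v}` an abelian-scheme model of
`A` at `v` (`IsAbelianSchemeModel A v 𝒜`) and `red_v = h.specialFibreReductionHom : A(K̄) → 𝒜_v(κ̄(v))` the reduction map of
`AbelianSchemeModelReduction` (valuative criterion along the rank-one valuation ring `R` of `K̄_v`).  [SerreTate1968GoodReduction]
§1 Lemma 2: «the reduction map defines an isomorphism of `A_m` onto `Ã_m` for `m` prime to `p`».  We prove: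

* `eq_of_comp_eq_of_formallyUnramified` — **section rigidity** (generic, Mathlib-level): for an unramified morphism
  `f : X → Y` locally of finite type and a LOCAL ring `R`, two points `s, t : Spec R → X` with `s ≫ f = t ≫ f` which agree at
  the closed point of `Spec R` are equal — the pair `(s, t)` lands in the OPEN diagonal of `f` (Mathlib
  `isOpenImmersion_diagonal`) at the closed point, hence at every point (every point of a local scheme specialises to the closed
  point), so it factors through the diagonal ([EGAIV4] 17.4.1; the uniqueness half of [BLRNeronModels1990] §2.2 Prop. 2).
  No separatedness, flatness or henselian hypothesis.
* `IsAbelianSchemeModel.specialFibreReductionHom_injOn_geomTorsion_of_formallyUnramified` — **if multiplication by `N` on the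
  model `𝒜` is unramified, `red_v` is injective on `A[N](K̄)`**: an `N`-torsion point in the kernel gives an `R`-section `s` of
  `𝒜` with `s ≫ [N]` = the unit section `≫ [N]` (both restrict to the unit `Ω`-point, `restrictPoint_bijective`) and with the same
  closed point as the unit section; by section rigidity `s` IS the unit section, so the point is zero
  (`toAdicCompletionPoints_injective`, `fractionFieldPointsEquiv`).
* `IsAbelianSchemeModel.specialFibreReductionHom_bijOn_geomTorsion_of_injOn` — **injective on `A[N]` ⇒ bijective onto
  `𝒜_v[N]`** for `(N) ∉ v`, by COUNTING: both groups have `N^{2 dim A}` elements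
  (`AbelianVariety.natCard_torsionPoints_of_isAlgClosed_holds` over `K̄` and over `κ̄(v)`, [MumfordAV1970] §6 Appl. 3, with
  `dim 𝒜_v = dim A`).
* `IsAbelianSchemeModel.specialFibreReductionHom_bijOn_geomTorsion_of_formallyUnramified` — the composition.

What remains for the full Lemma 2 is the single textbook input taken here as the hypothesis `hunr`: «`[N] : 𝒜 → 𝒜` is
unramified for `N ∈ 𝓞_{K,v}ˣ`» (it is étale: fibrewise `AbelianVariety.etale_zsmul_id_holds` + the fibrewise criterion,
[BLRNeronModels1990] 7.3/2, [EGAIV4] 17.8.2) — NOT proved in this file.  HC_CM is proved only modulo the 7 printed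
citations until rung 0 closes.

## References
* [SerreTate1968GoodReduction] J.-P. Serre, J. Tate, *Good reduction of abelian varieties*, Ann. of Math. 88 (1968), §1 Lemma 2.
* [MumfordAV1970] D. Mumford, *Abelian Varieties* (1970), §6 Application 3 (p. 64).
* [BLRNeronModels1990] S. Bosch, W. Lütkebohmert, M. Raynaud, *Néron Models* (1990), §2.2 Prop. 2, §7.3 Prop. 2.
* [EGAIV4] A. Grothendieck, EGA IV₄, Publ. Math. IHÉS 32 (1967), 17.4.1, 17.8.2.
-/

set_option autoImplicit false

noncomputable section

open CategoryTheory CategoryTheory.Limits AlgebraicGeometry IsDedekindDomain IsDedekindDomain.HeightOneSpectrum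
open scoped NumberField MonObj CategoryTheory.Obj
open Literature.AlgebraicGeometry.Motives (AbelianVariety SchemeOver specValuationSubring specFractionField
  specFractionFieldι specRingHomι restrictPoint extendPoint reducePointMonoidHom restrictPoint_extendPoint
  extendPoint_eq_iff reducePointMonoidHom_apply restrictPoint_bijective)
open Literature.NumberTheory.GaloisRepresentations (closureValuationSubring)

namespace Literature.NumberTheory.DiophantineGeometry

universe u

/-! ### Section rigidity for unramified morphisms -/

/-- **Section rigidity** ([EGAIV4] 17.4.1; the uniqueness argument of [BLRNeronModels1990] §2.2 Prop. 2): let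
`f : X → Y` be formally unramified and locally of finite type, `R` a local ring, and `s, t : Spec R → X` two points with
`s ≫ f = t ≫ f` that agree at the closed point of `Spec R` (after composition with `Spec κ(R) → Spec R`).  Then `s = t`.
Proof: the diagonal `Δ_f : X → X ×_Y X` is an open immersion (Mathlib `isOpenImmersion_diagonal`); the pair
`(s, t) : Spec R → X ×_Y X` sends the closed point into the image of `Δ_f`, hence every point (each point of `Spec R`
specialises to the closed point and the image of `Δ_f` is open), so `(s, t)` factors through `Δ_f` (`IsOpenImmersion.lift`)
and `s = t`. [cite: EGAIV4, Prop. 17.4.1] [cite: BLRNeronModels1990, §2.2 Prop. 2 (uniqueness of extensions)] -/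
theorem eq_of_comp_eq_of_formallyUnramified {X Y : Scheme.{u}} (f : X ⟶ Y) [FormallyUnramified f]
    [LocallyOfFiniteType f] {R : Type u} [CommRing R] [IsLocalRing R] (s t : Spec (.of R) ⟶ X)
    (hf : s ≫ f = t ≫ f)
    (h0 : Spec.map (CommRingCat.ofHom (IsLocalRing.residue R)) ≫ s =
      Spec.map (CommRingCat.ofHom (IsLocalRing.residue R)) ≫ t) : s = t := by
  let g : Spec (.of R) ⟶ pullback f f := pullback.lift s t hf
  -- at the closed point, `(s, t)` lies in the (open) diagonal
  have hcl : g.base (IsLocalRing.closedPoint R) ∈ Set.range (pullback.diagonal f).base := by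
    have hpt : (Spec.map (CommRingCat.ofHom (IsLocalRing.residue R))).base
        (IsLocalRing.closedPoint (IsLocalRing.ResidueField R)) = IsLocalRing.closedPoint R :=
      IsLocalRing.PrimeSpectrum.comap_residue R _
    have hfac : Spec.map (CommRingCat.ofHom (IsLocalRing.residue R)) ≫ g =
        (Spec.map (CommRingCat.ofHom (IsLocalRing.residue R)) ≫ s) ≫ pullback.diagonal f := by
      apply pullback.hom_ext
      · rw [Category.assoc, pullback.lift_fst, Category.assoc, pullback.diagonal_fst, Category.comp_id]
      · rw [Category.assoc, pullback.lift_snd, Category.assoc, pullback.diagonal_snd, Category.comp_id, h0]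
    refine ⟨(Spec.map (CommRingCat.ofHom (IsLocalRing.residue R)) ≫ s).base
      (IsLocalRing.closedPoint (IsLocalRing.ResidueField R)), ?_⟩
    rw [← hpt, ← Scheme.Hom.comp_apply, ← Scheme.Hom.comp_apply, hfac]
  -- hence everywhere (the base is local: every point specialises to the closed point)
  have hrange : Set.range g.base ⊆ Set.range (pullback.diagonal f).base := by
    rintro _ ⟨x, rfl⟩
    exact ((IsLocalRing.specializes_closedPoint x).map g.base.hom.continuous).mem_open
      (pullback.diagonal f).isOpenEmbedding.isOpen_range hcl
  have hl := IsOpenImmersion.lift_fac (pullback.diagonal f) g hrange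
  calc s = g ≫ pullback.fst f f := (pullback.lift_fst s t hf).symm
    _ = IsOpenImmersion.lift (pullback.diagonal f) g hrange ≫ pullback.diagonal f ≫ pullback.fst f f := by
        rw [← Category.assoc, hl]
    _ = IsOpenImmersion.lift (pullback.diagonal f) g hrange ≫ pullback.diagonal f ≫ pullback.snd f f := by
        rw [pullback.diagonal_fst, pullback.diagonal_snd]
    _ = g ≫ pullback.snd f f := by rw [← Category.assoc, hl]
    _ = t := pullback.lift_snd s t hf

/-! ### Injectivity of the reduction map on torsion from unramified `[N]` -/

variable {K : Type} [Field K] [NumberField K] {v : HeightOneSpectrum (𝓞 K)}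
  {A : AbelianVariety K} {𝒜 : SchemeOver (valuationSubringAtPrime K v)} [GrpObj 𝒜]

/-- **`red_v` is injective on `A[N](K̄)` if multiplication by `N` on the model is unramified** ([SerreTate1968GoodReduction] §1
Lemma 2, injectivity half; [BLRNeronModels1990] 7.3/2–3).  Here `[N] = (𝟙 𝒜) ^ N` in the group `Hom(𝒜, 𝒜)` of the group scheme
`𝒜` (Mathlib's pointwise structure), and `hunr` asks that its underlying morphism of schemes be formally unramified (true for
`N ∈ 𝓞_{K,v}ˣ`: `[N]` is then étale — NOT proved here).  Proof: for `z ∈ A[N](K̄)` with `red_v z = 0`, the `Ω`-point `P` of `𝒜`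
attached to `z` (`toAdicCompletionPoints`, `fractionFieldPointsEquiv`) satisfies `P ^ N = 1`; its extension `s = extendPoint P`
to the valuation ring `R` of `Ω = K̄_v` and the unit section `1` satisfy `s ≫ [N] = 1 ≫ [N]` (both restrict to `P ^ N = 1 = 1 ^ N`,
`restrictPoint_bijective`) and agree at the closed point (that is `red_v z = 0`); section rigidity
(`eq_of_comp_eq_of_formallyUnramified`, `R` is local) gives `s = 1`, so `P = 1` and `z = 0` (`toAdicCompletionPoints_injective`).
[cite: SerreTate1968GoodReduction, §1 Lemma 2] [cite: BLRNeronModels1990, §7.3 Prop. 2–3] -/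
theorem IsAbelianSchemeModel.specialFibreReductionHom_injOn_geomTorsion_of_formallyUnramified
    (h : IsAbelianSchemeModel A v 𝒜) (N : ℕ)
    (hunr : FormallyUnramified (((𝟙 𝒜 : 𝒜 ⟶ 𝒜) ^ N) : 𝒜 ⟶ 𝒜).left) :
    Set.InjOn h.specialFibreReductionHom (A.geomTorsion (N : ℤ)) := by
  classical
  haveI := h.isProper
  haveI := hunr
  set R := closureValuationSubring (v.adicCompletion K) with hR
  -- `[N]` is locally of finite type (both source and target are, over `𝓞_{K,v}`)
  haveI : LocallyOfFiniteType (((𝟙 𝒜 : 𝒜 ⟶ 𝒜) ^ N) : 𝒜 ⟶ 𝒜).left := by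
    have hw : (((𝟙 𝒜 : 𝒜 ⟶ 𝒜) ^ N) : 𝒜 ⟶ 𝒜).left ≫ 𝒜.hom = 𝒜.hom := Over.w _
    haveI := h.smooth
    haveI : Smooth 𝒜.hom := SmoothOfRelativeDimension.smooth A.dim 𝒜.hom
    haveI : LocallyOfFiniteType ((((𝟙 𝒜 : 𝒜 ⟶ 𝒜) ^ N) : 𝒜 ⟶ 𝒜).left ≫ 𝒜.hom) := by
      rw [hw]; infer_instance
    exact locallyOfFiniteType_of_comp _ 𝒜.hom
  -- it suffices to show that the kernel meets the torsion trivially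
  intro x hx y hy hxy
  rw [← sub_eq_zero]
  have hxy' : h.specialFibreReductionHom (x - y) = 0 := by rw [map_sub, hxy, sub_self]
  have hmem : x - y ∈ A.geomTorsion (N : ℤ) := (A.geomTorsion (N : ℤ)).sub_mem hx hy
  generalize x - y = z at hxy' hmem
  -- unfold the reduction map: `z ↦ Q ↦ P ↦ extendPoint P ↦ reduce`
  rw [h.specialFibreReductionHom_apply, map_eq_zero_iff _ h.additiveResidueFieldPointsEquiv.injective,
    h.geomReductionHom_apply] at hxy'
  set Q := toAdicCompletionPoints A v (Additive.toMul z) with hQ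
  have hz1 : h.reductionHom Q = 1 := hxy'
  set P := h.fractionFieldPointsEquiv.symm Q with hP
  have hPN : P ^ N = 1 := by
    rw [hP, ← map_pow, hQ, ← map_pow]
    have : (Additive.toMul z) ^ N = 1 := by
      have := (AbelianVariety.mem_geomTorsion_iff' z).mp hmem
      rw [← zpow_natCast]
      exact this
    rw [this, map_one, map_one]
  rw [h.reductionHom_apply, reducePointMonoidHom_apply] at hz1
  -- the two `R`-points: the extension `s` of `P` and the unit section `1`
  set s := extendPoint R (toClosureValuationSubring v) 𝒜 P with hs
  have ht : extendPoint R (toClosureValuationSubring v) 𝒜 1 = 1 :=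
    (extendPoint_eq_iff R _ 𝒜 1 1).mpr (MonObj.comp_one _)
  have hred1 : reducePointMonoidHom R (toClosureValuationSubring v) 𝒜 (IsLocalRing.residue R) 1 = 1 := map_one _
  rw [reducePointMonoidHom_apply, ht] at hred1
  -- `s ≫ [N] = 1 ≫ [N]` (both restrict to the unit `Ω`-point) and `s`, `1` agree at the closed point
  have hsN : s ≫ ((𝟙 𝒜 : 𝒜 ⟶ 𝒜) ^ N) = (1 : specValuationSubring R (toClosureValuationSubring v) ⟶ 𝒜) ≫
      ((𝟙 𝒜 : 𝒜 ⟶ 𝒜) ^ N) := by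
    apply (restrictPoint_bijective R (toClosureValuationSubring v) 𝒜).1
    change specFractionFieldι R _ ≫ s ≫ _ = specFractionFieldι R _ ≫ 1 ≫ _
    rw [← Category.assoc, ← Category.assoc, MonObj.comp_pow, MonObj.comp_pow, Category.comp_id,
      Category.comp_id, MonObj.comp_one]
    change restrictPoint R _ 𝒜 s ^ N = 1 ^ N
    rw [hs, restrictPoint_extendPoint, hPN, one_pow]
  have hst : s = 1 := by
    apply Over.OverMorphism.ext
    refine eq_of_comp_eq_of_formallyUnramified (((𝟙 𝒜 : 𝒜 ⟶ 𝒜) ^ N) : 𝒜 ⟶ 𝒜).left s.left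
      (1 : specValuationSubring R (toClosureValuationSubring v) ⟶ 𝒜).left ?_ ?_
    · exact congrArg CommaMorphism.left hsN
    · have e1 := congrArg CommaMorphism.left hz1
      have e2 := congrArg CommaMorphism.left hred1
      exact e1.trans e2.symm
  -- conclude: `P = 1`, `Q = 1`, `z = 0`
  have hP1 : P = 1 := by
    rw [← restrictPoint_extendPoint R (toClosureValuationSubring v) 𝒜 P, ← hs, hst]
    exact MonObj.comp_one _
  have hQ1 : Q = 1 := by
    rw [← h.fractionFieldPointsEquiv.apply_symm_apply Q, ← hP, hP1, map_one]
  have hz : Additive.toMul z = 1 := toAdicCompletionPoints_injective A v (by rw [← hQ, hQ1, map_one])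
  exact toMul_eq_one.mp hz

/-! ### Bijectivity from injectivity, by counting -/

omit [NumberField K] in
/-- A natural number prime to `v` is non-zero in the residue field `κ(v)`. [folklore] -/
private theorem natCast_residueField_ne_zero_of_not_mem {N : ℕ} (hN : ((N : ℕ) : 𝓞 K) ∉ v.asIdeal) :
    (N : v.asIdeal.ResidueField) ≠ 0 := by
  rw [← map_natCast (algebraMap (𝓞 K) v.asIdeal.ResidueField) N, Ne, Ideal.algebraMap_residueField_eq_zero]
  exact hN

/-- **`#𝒜_v[N](κ̄(v)) = N^{2 dim A}` for `(N) ∉ v`**: the special fibre of an abelian-scheme model of `A` is an abelian variety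
over `κ(v)` of dimension `dim A` (`dim_specialFibre_of_isAbelianSchemeModel`) and `N` is invertible in `κ(v)`
([MumfordAV1970] §6 Application 3, through `AbelianVariety.natCard_torsionPoints_of_isAlgClosed_holds`).
[cite: MumfordAV1970, §6 Application 3 (Proposition p. 64)] -/
theorem IsAbelianSchemeModel.natCard_geomTorsion_specialFibre (h : IsAbelianSchemeModel A v 𝒜) {N : ℕ}
    (hN : ((N : ℕ) : 𝓞 K) ∉ v.asIdeal) :
    Nat.card (h.specialFibre.geomTorsion (N : ℤ)) = N ^ (2 * A.dim) := by
  rw [h.specialFibre.natCard_geomTorsion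
      (AbelianVariety.natCard_torsionPoints_of_isAlgClosed_holds h.specialFibre _) (N : ℤ)
      (by rw [Int.cast_natCast]; exact natCast_residueField_ne_zero_of_not_mem hN),
    Int.natAbs_natCast, Literature.AlgebraicGeometry.Motives.AbelianVariety.dim_specialFibre_of_isAbelianSchemeModel h]

/-- **`#A[N](K̄) = N^{2 dim A}`** for `N ≠ 0` (characteristic zero; [MumfordAV1970] §6 Application 3, through the tree's
`AbelianVariety.natCard_torsionPoints_of_isAlgClosed_holds`). [cite: MumfordAV1970, §6 Application 3 (Proposition p. 64)] -/
theorem natCard_geomTorsion_of_ne_zero (A : AbelianVariety K) {N : ℕ} (hN : N ≠ 0) :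
    Nat.card (A.geomTorsion (N : ℤ)) = N ^ (2 * A.dim) := by
  rw [A.natCard_geomTorsion (AbelianVariety.natCard_torsionPoints_of_isAlgClosed_holds A _) (N : ℤ)
      (by rw [Int.cast_natCast]; exact Nat.cast_ne_zero.mpr hN), Int.natAbs_natCast]

/-- **Injective on `A[N](K̄)` ⇒ bijective onto `𝒜_v[N](κ̄(v))`**, for `(N) ∉ v` ([SerreTate1968GoodReduction] §1 Lemma 2,
surjectivity half by counting): `red_v` maps `N`-torsion to `N`-torsion (it is additive), and both groups are finite of the same
order `N^{2 dim A}` (`natCard_geomTorsion_of_ne_zero`, `natCard_geomTorsion_specialFibre`), so an injection is a bijection.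
[cite: SerreTate1968GoodReduction, §1 Lemma 2] [cite: MumfordAV1970, §6 Application 3 (Proposition p. 64)] -/
theorem IsAbelianSchemeModel.specialFibreReductionHom_bijOn_geomTorsion_of_injOn
    (h : IsAbelianSchemeModel A v 𝒜) {N : ℕ} (hN : ((N : ℕ) : 𝓞 K) ∉ v.asIdeal)
    (hinj : Set.InjOn h.specialFibreReductionHom (A.geomTorsion (N : ℤ))) :
    Set.BijOn h.specialFibreReductionHom (A.geomTorsion (N : ℤ)) (h.specialFibre.geomTorsion (N : ℤ)) := by
  classical
  have hN0 : N ≠ 0 := by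
    rintro rfl
    exact hN (by rw [Nat.cast_zero]; exact v.asIdeal.zero_mem)
  -- maps torsion to torsion
  have hmaps : Set.MapsTo h.specialFibreReductionHom (A.geomTorsion (N : ℤ)) (h.specialFibre.geomTorsion (N : ℤ)) := by
    intro x hx
    rw [SetLike.mem_coe, AbelianVariety.mem_geomTorsion_iff'] at hx ⊢
    rw [← map_zsmul, hx, map_zero]
  refine ⟨hmaps, hinj, ?_⟩
  -- surjective by counting: both torsion groups have `N ^ (2 dim A)` elements
  let f : A.geomTorsion (N : ℤ) → h.specialFibre.geomTorsion (N : ℤ) := hmaps.restrict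
  have hf : Function.Injective f := (Set.MapsTo.restrict_inj hmaps).mpr hinj
  have hcA := natCard_geomTorsion_of_ne_zero A hN0
  have hcB := h.natCard_geomTorsion_specialFibre hN
  haveI : Finite (h.specialFibre.geomTorsion (N : ℤ)) :=
    Nat.finite_of_card_ne_zero (by rw [hcB]; exact pow_ne_zero _ hN0)
  have hbij : Function.Bijective f := hf.bijective_of_nat_card_le (by rw [hcA, hcB])
  intro y hy
  obtain ⟨x, hx⟩ := hbij.2 ⟨y, hy⟩
  exact ⟨x, x.2, congrArg Subtype.val hx⟩

/-- **`red_v : A[N](K̄) → 𝒜_v[N](κ̄(v))` is a bijection for `(N) ∉ v`, granted that `[N]` is unramified on the model**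
([SerreTate1968GoodReduction] §1 Lemma 2: «the reduction map defines an isomorphism of `A_m` onto `Ã_m`» for `m` prime to the
residue characteristic) — composition of `…_injOn_geomTorsion_of_formallyUnramified` and `…_bijOn_geomTorsion_of_injOn`.
[cite: SerreTate1968GoodReduction, §1 Lemma 2] -/
theorem IsAbelianSchemeModel.specialFibreReductionHom_bijOn_geomTorsion_of_formallyUnramified
    (h : IsAbelianSchemeModel A v 𝒜) {N : ℕ} (hN : ((N : ℕ) : 𝓞 K) ∉ v.asIdeal)
    (hunr : FormallyUnramified (((𝟙 𝒜 : 𝒜 ⟶ 𝒜) ^ N) : 𝒜 ⟶ 𝒜).left) :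
    Set.BijOn h.specialFibreReductionHom (A.geomTorsion (N : ℤ)) (h.specialFibre.geomTorsion (N : ℤ)) :=
  h.specialFibreReductionHom_bijOn_geomTorsion_of_injOn hN
    (h.specialFibreReductionHom_injOn_geomTorsion_of_formallyUnramified N hunr)

end Literature.NumberTheory.DiophantineGeometry

end
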